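import Literature.Computability.QuantumComplexity.Lemma24Copies
import Literature.Computability.QuantumComplexity.ReversibleCliffordT
import Literature.Computability.Cryptography.QubitRegisterCliffordTProofs
import HarnessLib

/-!
# Aaronson–Ambainis Lemma 24 over the sign basis, VIII: the working circuit of a block

Eighth file of the discharge of `AaronsonAmbainis2018_lemma24_sign_hard` (plan in
`Lemma24Catalysis.lean`). For a Clifford+`T` circuit `C` on `w = n + m` wires (inputs first, `m`
ancillas) and a classical input `x ∈ {0,1}ⁿ`, the **working circuit** of a block is the Clifford+`T`
gate list on `Kw w = 4w + 4` wires

  `mainGates C x = revCompile (prepOps x) ++ copiesGates C ++ revCompile (orOps w)`: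

write `x` on the input wires of each of four copies of the register of `C` (blocks
`copyEmb i : Fin w ↪ Fin (Kw w)`, wires `i·w + j`), run `C` on every copy (`mapWires`), and compute the
OR of the four acceptance wires (wire `0` of each copy) into the flag wire `flagW = 4w + 2` with three
Toffoli gates through the ancillas `4w, 4w + 1` (the fresh wire `4w + 3` is reserved for the copy trick
and never touched). Everything is classical bookkeeping on top of the tree's `CircuitEmbedding.lean`
(product states, the frame rule), `ReversibleCliffordT.lean` (`revCompile`, `revEval`) and file V:

* the layout and its disjointness; `revEval_injective` (reversible programs permute the labels);
* `revEval_prepOps_zero` — the prepared basis label `prepLabel x` and `prepLabel_comp_copyEmb = padInput x m`;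
* `revEval_orOps_flagW` — on labels with clean ancillas the flag becomes the OR of the acceptance wires;
* **`flagWeight_mainState`**: the Born weight of `flagW = 1` in
  `mainState C x = ⟦mainGates C x⟧ |0…0⟩` is `1 − (1 − p)^4`, `p = C.acceptProb 0 x`;
* wires (`freshW_not_mem_wires_mainGates`), oracle-freeness and size of `mainGates`.

## References

* S. Aaronson, A. Ambainis, *Forrelation*, SIAM J. Comput. 47 (2018), §6, Lemma 24 (p. 26).
* M. A. Nielsen, I. L. Chuang, *Quantum Computation and Quantum Information*, CUP 2010, §3.2.5
  (reversible classical computation), Box 3.4 (repetition), §2.2.8.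
-/

noncomputable section

namespace Literature.Computability.QuantumComplexity

open Matrix _root_.Computability Complexity Cryptography Finset

namespace Lemma24

/-! ### Reversible programs permute the basis labels -/

variable {N : ℕ}

/-- Every reversible operation is an involution on labels. [cite: NielsenChuang2010, §3.2.5] -/
theorem _root_.Literature.Computability.QuantumComplexity.RevOp.eval_eval (op : RevOp N) (z : QReg N) : op.eval (op.eval z) = z := by
  rcases op with i | ⟨i, j, h⟩ | ⟨a, b, c, hab, hac, hbc⟩
  · funext q
    simp only [RevOp.eval]
    by_cases hq : q = i
    · subst hq; simp
    · simp [Function.update_of_ne hq]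
  · funext q
    simp only [RevOp.eval]
    by_cases hq : q = j
    · subst hq; simp [Function.update_of_ne h]
    · simp [Function.update_of_ne hq]
  · funext q
    simp only [RevOp.eval]
    by_cases hq : q = c
    · subst hq
      simp [Function.update_of_ne hac, Function.update_of_ne hbc]
    · simp [Function.update_of_ne hq]

/-- **Reversible programs are injective on labels.** [cite: NielsenChuang2010, §3.2.5] -/
theorem revEval_injective (ops : List (RevOp N)) : Function.Injective (revEval ops) := by
  induction ops with
  | nil => exact fun a b h => h
  | cons op ops ih =>
    intro a b h
    have h' : op.eval a = op.eval b := ih h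
    have := congrArg op.eval h'
    rwa [RevOp.eval_eval, RevOp.eval_eval] at this

/-- A reversible program as an injective self-map of the labels. [cite: NielsenChuang2010, §3.2.5] -/
def revPerm (ops : List (RevOp N)) : QReg N ↪ QReg N := ⟨revEval ops, revEval_injective ops⟩

/-- A list of `NOT`s on distinct wires flips exactly those wires. [cite: NielsenChuang2010, §3.2.5] -/
theorem revEval_map_not : ∀ (L : List (Fin N)), L.Nodup → ∀ (v : QReg N),
    revEval (L.map RevOp.not) v = fun q => if q ∈ L then !v q else v q
  | [], _, v => by funext q; simp [revEval]
  | a :: L, hL, v => by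
    have ha : a ∉ L := (List.nodup_cons.1 hL).1
    funext q
    rw [List.map_cons, revEval, revEval_map_not L (List.nodup_cons.1 hL).2]
    simp only [RevOp.eval, List.mem_cons]
    by_cases hqa : q = a
    · subst hqa; simp [ha]
    · simp [hqa]

/-- The wires mentioned by a reversible operation. [folklore] -/
def _root_.Literature.Computability.QuantumComplexity.RevOp.wireSet : RevOp N → Finset (Fin N)
  | .not i => {i}
  | .cnot i j _ => {i, j}
  | .toffoli a b c _ _ _ => {a, b, c}

/-- Wires of a gate placed on one wire. [folklore] -/
theorem wires_gate_wireEmb (op : CliffordTOp) (i : Fin N) (h : cliffordT.arity op = 1) :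
    ∀ (e : Fin (cliffordT.arity op) ↪ Fin N), (∀ j, e j = i) → (QGate.gate op e : QGate cliffordT N).wires = {i} := by
  intro e he
  ext q
  simp only [QGate.wires, Finset.mem_map, Finset.mem_univ, true_and, Finset.mem_singleton]
  constructor
  · rintro ⟨j, rfl⟩; exact he j
  · rintro rfl
    have : 0 < cliffordT.arity op := by omega
    exact ⟨⟨0, this⟩, he _⟩

/-- Wires of `hOn`. [folklore] -/
@[simp] theorem wires_hOn (i : Fin N) : (hOn i : QGate cliffordT N).wires = {i} :=
  wires_gate_wireEmb _ i rfl _ (fun _ => rfl)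
/-- Wires of `sOn`. [folklore] -/
@[simp] theorem wires_sOn (i : Fin N) : (sOn i : QGate cliffordT N).wires = {i} :=
  wires_gate_wireEmb _ i rfl _ (fun _ => rfl)
/-- Wires of `tOn`. [folklore] -/
@[simp] theorem wires_tOn (i : Fin N) : (tOn i : QGate cliffordT N).wires = {i} :=
  wires_gate_wireEmb _ i rfl _ (fun _ => rfl)
/-- Wires of `cnotOn`. [folklore] -/
@[simp] theorem wires_cnotOn (i j : Fin N) (h : i ≠ j) : (cnotOn i j h : QGate cliffordT N).wires = {i, j} := by
  ext q
  simp only [cnotOn, QGate.wires, Finset.mem_map, Finset.mem_univ, true_and, Finset.mem_insert, Finset.mem_singleton]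
  constructor
  · rintro ⟨l, rfl⟩
    fin_cases l
    · exact Or.inl rfl
    · exact Or.inr rfl
  · rintro (rfl | rfl)
    · exact ⟨(0 : Fin 2), rfl⟩
    · exact ⟨(1 : Fin 2), rfl⟩

/-- **The gates of a compiled reversible operation act within its wires.** [cite: NielsenChuang2010, §3.2.5] -/
theorem wires_subset_wireSet_of_mem_compile {op : RevOp N} {g : QGate cliffordT N} (hg : g ∈ op.compile) :
    g.wires ⊆ op.wireSet := by
  rcases op with i | ⟨i, j, h⟩ | ⟨a, b, c, hab, hac, hbc⟩
  · simp only [RevOp.compile, xWord, List.mem_cons, List.mem_nil_iff, or_false] at hg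
    rcases hg with rfl | rfl | rfl | rfl <;> simp [RevOp.wireSet]
  · simp only [RevOp.compile, List.mem_singleton] at hg
    subst hg; simp [RevOp.wireSet]
  · simp only [RevOp.compile, toffoliWord, cczWord, List.mem_cons, List.mem_append, List.mem_nil_iff, or_false] at hg
    rcases hg with rfl | hg | rfl
    · simp [RevOp.wireSet, Finset.subset_iff]
    · rcases hg with rfl | rfl | rfl | rfl | rfl | rfl | rfl | rfl | rfl | rfl | rfl | rfl | rfl | rfl | rfl | rfl | rfl |
          rfl | rfl | rfl | rfl | rfl <;> simp [RevOp.wireSet, Finset.subset_iff]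
    · simp [RevOp.wireSet, Finset.subset_iff]

/-- The gates of a compiled program act within the wires of its operations. [cite: NielsenChuang2010, §3.2.5] -/
theorem exists_wireSet_of_mem_revCompile {ops : List (RevOp N)} {g : QGate cliffordT N} (hg : g ∈ revCompile ops) :
    ∃ op ∈ ops, g.wires ⊆ op.wireSet := by
  simp only [revCompile, List.mem_flatMap] at hg
  obtain ⟨op, hop, hg⟩ := hg
  exact ⟨op, hop, wires_subset_wireSet_of_mem_compile hg⟩

/-! ### The layout of a block's working register -/

variable {w : ℕ}

/-- The width `4w + 4` of the working register: four copies of `w` wires, two ancillas, the flag,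
the fresh wire. [cite: AaronsonAmbainis2018, §6 Lemma 24 (p. 26)] -/
def Kw (w : ℕ) : ℕ := 4 * w + 4

/-- Wire `j` of copy `i`: index `i·w + j`. [folklore] -/
def cw (i : Fin 4) (j : Fin w) : Fin (Kw w) :=
  ⟨i * w + j, by
    have hi : (i : ℕ) ≤ 3 := by have := i.isLt; omega
    have hj := j.isLt
    unfold Kw; nlinarith⟩

/-- The value of `cw`. [folklore] -/
@[simp] theorem cw_val (i : Fin 4) (j : Fin w) : (cw i j : ℕ) = i * w + j := rfl

/-- The first ancilla `4w`. [folklore] -/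
def anc1W (w : ℕ) : Fin (Kw w) := ⟨4 * w, by unfold Kw; omega⟩
/-- The second ancilla `4w + 1`. [folklore] -/
def anc2W (w : ℕ) : Fin (Kw w) := ⟨4 * w + 1, by unfold Kw; omega⟩
/-- The flag wire `4w + 2`. [folklore] -/
def flagW (w : ℕ) : Fin (Kw w) := ⟨4 * w + 2, by unfold Kw; omega⟩
/-- The fresh wire `4w + 3` (never touched by the working circuit). [folklore] -/
def freshW (w : ℕ) : Fin (Kw w) := ⟨4 * w + 3, by unfold Kw; omega⟩

/-- The value of `anc1W`. [folklore] -/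
@[simp] theorem anc1W_val (w : ℕ) : (anc1W w : ℕ) = 4 * w := rfl
/-- The value of `anc2W`. [folklore] -/
@[simp] theorem anc2W_val (w : ℕ) : (anc2W w : ℕ) = 4 * w + 1 := rfl
/-- The value of `flagW`. [folklore] -/
@[simp] theorem flagW_val (w : ℕ) : (flagW w : ℕ) = 4 * w + 2 := rfl
/-- The value of `freshW`. [folklore] -/
@[simp] theorem freshW_val (w : ℕ) : (freshW w : ℕ) = 4 * w + 3 := rfl

/-- A copy wire is below `4w`. [folklore] -/
theorem cw_val_lt (i : Fin 4) (j : Fin w) : (cw i j : ℕ) < 4 * w := by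
  have hi : (i : ℕ) ≤ 3 := by have := i.isLt; omega
  have hj := j.isLt
  simp only [cw_val]; nlinarith

/-- `cw` is injective in the wire. [folklore] -/
theorem cw_injective (i : Fin 4) : Function.Injective (cw (w := w) i) := by
  intro j j' h
  have := congrArg Fin.val h
  simp only [cw_val] at this
  exact Fin.ext (by omega)

/-- **The block of copy `i`.** [cite: NielsenChuang2010, §2.1.7] -/
def copyEmb (i : Fin 4) : Fin w ↪ Fin (Kw w) := ⟨cw i, cw_injective i⟩

/-- `copyEmb i j = cw i j`. [folklore] -/
@[simp] theorem copyEmb_apply (i : Fin 4) (j : Fin w) : copyEmb i j = cw i j := rfl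

/-- Distinct copies use distinct wires. [folklore] -/
theorem cw_ne_cw {i i' : Fin 4} (h : i ≠ i') (j j' : Fin w) : cw i j ≠ cw i' j' := by
  intro he
  have hv := congrArg Fin.val he
  simp only [cw_val] at hv
  have hj := j.isLt; have hj' := j'.isLt
  rcases lt_or_gt_of_ne (Fin.val_ne_of_ne h) with hlt | hlt
  · have : (i : ℕ) + 1 ≤ i' := hlt
    nlinarith
  · have : (i' : ℕ) + 1 ≤ i := hlt
    nlinarith

/-- **The copies are pairwise disjoint blocks.** [cite: NielsenChuang2010, §2.1.7] -/
theorem copyEmb_blockDisjoint : BlockDisjoint (copyEmb (w := w)) := by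
  intro i i' h
  refine Set.disjoint_left.2 ?_
  rintro q ⟨j, rfl⟩ ⟨j', hj'⟩
  exact cw_ne_cw h j j' (by simpa using hj'.symm)

/-- The special wires are off the copies. [folklore] -/
theorem offBlocks_of_le {q : Fin (Kw w)} (hq : 4 * w ≤ (q : ℕ)) : OffBlocks (copyEmb (w := w)) q := by
  rintro i ⟨j, hj⟩
  have := cw_val_lt i j
  rw [copyEmb_apply] at hj
  rw [← hj] at hq
  omega

/-- The first ancilla is off the copies. [folklore] -/
theorem offBlocks_anc1W : OffBlocks (copyEmb (w := w)) (anc1W w) := offBlocks_of_le (by simp)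
/-- The second ancilla is off the copies. [folklore] -/
theorem offBlocks_anc2W : OffBlocks (copyEmb (w := w)) (anc2W w) := offBlocks_of_le (by simp)
/-- The flag is off the copies. [folklore] -/
theorem offBlocks_flagW : OffBlocks (copyEmb (w := w)) (flagW w) := offBlocks_of_le (by simp)
/-- The fresh wire is off the copies. [folklore] -/
theorem offBlocks_freshW : OffBlocks (copyEmb (w := w)) (freshW w) := offBlocks_of_le (by simp)

/-! ### Writing the input on every copy -/

variable {n m : ℕ}

/-- The wires to flip: the input wires of every copy carrying a `1` of `x`. [cite: NielsenChuang2010, §3.2.5] -/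
def prepWires (x : QReg n) : List (Fin (Kw (n + m))) :=
  (List.finRange 4).flatMap fun i => (List.finRange n).filterMap fun l =>
    if x l = true then some (cw i (Fin.castAdd m l)) else none

/-- The preparation program: `NOT` on each wire of `prepWires`. [cite: NielsenChuang2010, §3.2.5] -/
def prepOps (x : QReg n) : List (RevOp (Kw (n + m))) := (prepWires (m := m) x).map RevOp.not

/-- Membership in `prepWires`. [folklore] -/
theorem mem_prepWires_iff (x : QReg n) (q : Fin (Kw (n + m))) :
    q ∈ prepWires (m := m) x ↔ ∃ i : Fin 4, ∃ l : Fin n, x l = true ∧ q = cw i (Fin.castAdd m l) := by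
  simp only [prepWires, List.mem_flatMap, List.mem_finRange, true_and, List.mem_filterMap]
  constructor
  · rintro ⟨i, l, h⟩
    by_cases hx : x l = true
    · rw [if_pos hx] at h; exact ⟨i, l, hx, (Option.some_injective _ h).symm⟩
    · rw [if_neg hx] at h; exact absurd h (by simp)
  · rintro ⟨i, l, hx, rfl⟩
    exact ⟨i, l, by rw [if_pos hx]⟩

/-- `prepWires` has no duplicates. [folklore] -/
theorem nodup_prepWires (x : QReg n) : (prepWires (m := m) x).Nodup := by
  unfold prepWires
  refine List.nodup_flatMap.2 ⟨fun i _ => ?_, ?_⟩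
  · refine List.Nodup.filterMap ?_ (List.nodup_finRange n)
    intro l l' q hq hq'
    by_cases hx : x l = true
    · by_cases hx' : x l' = true
      · rw [if_pos hx] at hq; rw [if_pos hx'] at hq'
        have := (Option.some_injective _ hq).trans (Option.some_injective _ hq').symm
        exact Fin.castAdd_injective _ _ (cw_injective i this)
      · rw [if_neg hx'] at hq'; exact absurd hq' (by simp)
    · rw [if_neg hx] at hq; exact absurd hq (by simp)
  · refine List.Pairwise.imp_of_mem ?_ (List.nodup_finRange 4)
    intro i i' _ _ hii'
    simp only [Function.onFun, List.disjoint_left, List.mem_filterMap, List.mem_finRange, true_and]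
    rintro q ⟨l, hl⟩ ⟨l', hl'⟩
    by_cases hx : x l = true
    · by_cases hx' : x l' = true
      · rw [if_pos hx] at hl; rw [if_pos hx'] at hl'
        exact cw_ne_cw hii' _ _ ((Option.some_injective _ hl).trans (Option.some_injective _ hl').symm)
      · rw [if_neg hx'] at hl'; exact absurd hl' (by simp)
    · rw [if_neg hx] at hl; exact absurd hl (by simp)

/-- **The prepared label**: `x` on the input wires of each copy, `0` elsewhere. [cite: AaronsonAmbainis2018, §6 Lemma 24 (p. 26)] -/
def prepLabel (x : QReg n) : QReg (Kw (n + m)) := fun q => decide (q ∈ prepWires (m := m) x)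

/-- **The preparation program writes the prepared label.** [cite: NielsenChuang2010, §3.2.5] -/
theorem revEval_prepOps_zero (x : QReg n) : revEval (prepOps (m := m) x) (fun _ => false) = prepLabel (m := m) x := by
  rw [prepOps, revEval_map_not _ (nodup_prepWires x)]
  funext q
  by_cases h : q ∈ prepWires (m := m) x <;> simp [prepLabel, h]

/-- **Each copy reads `|x 0^m⟩`**: `prepLabel x ∘ copyEmb i = padInput x m`. [cite: AaronsonAmbainis2018, §6 Lemma 24 (p. 26)] -/
theorem prepLabel_comp_copyEmb (x : QReg n) (i : Fin 4) : prepLabel (m := m) x ∘ copyEmb i = padInput x m := by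
  funext j
  simp only [Function.comp_apply, copyEmb_apply, prepLabel]
  rw [padInput]
  refine j.addCases (fun l => ?_) (fun l => ?_)
  · rw [Fin.append_left]
    by_cases hx : x l = true
    · rw [hx, decide_eq_true_iff, mem_prepWires_iff]
      exact ⟨i, l, hx, rfl⟩
    · have hx' : x l = false := by simpa using hx
      rw [hx', decide_eq_false_iff_not, mem_prepWires_iff]
      rintro ⟨i', l', hx'', he⟩
      have hv := congrArg Fin.val he
      simp only [cw_val, Fin.val_castAdd] at hv
      have hl := l.isLt; have hl' := l'.isLt
      rcases lt_trichotomy (i : ℕ) i' with hlt | heq | hlt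
      · have : (i : ℕ) + 1 ≤ i' := hlt; nlinarith
      · have : (l : ℕ) = l' := by rw [heq] at hv; omega
        rw [Fin.ext this, hx''] at hx'; exact Bool.noConfusion hx'
      · have : (i' : ℕ) + 1 ≤ i := hlt; nlinarith
  · rw [Fin.append_right, decide_eq_false_iff_not, mem_prepWires_iff]
    rintro ⟨i', l', -, he⟩
    have hv := congrArg Fin.val he
    simp only [cw_val, Fin.val_natAdd, Fin.val_castAdd] at hv
    have hl := l.isLt; have hl' := l'.isLt
    rcases lt_trichotomy (i : ℕ) i' with hlt | heq | hlt
    · have : (i : ℕ) + 1 ≤ i' := hlt; nlinarith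
    · rw [heq] at hv; omega
    · have : (i' : ℕ) + 1 ≤ i := hlt; nlinarith

/-- The prepared label is `0` off the copies. [folklore] -/
theorem prepLabel_of_le (x : QReg n) {q : Fin (Kw (n + m))} (hq : 4 * (n + m) ≤ (q : ℕ)) : prepLabel (m := m) x q = false := by
  rw [prepLabel, decide_eq_false_iff_not, mem_prepWires_iff]
  rintro ⟨i, l, -, rfl⟩
  have := cw_val_lt i (Fin.castAdd m l)
  omega

/-! ### The OR of the acceptance wires -/

/-- The acceptance wire (wire `0`) of copy `i` (for a nonempty register). [folklore] -/
def accW (hw : 0 < w) (i : Fin 4) : Fin (Kw w) := cw i ⟨0, hw⟩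

/-- An acceptance wire is not the first ancilla. [folklore] -/
theorem accW_ne_anc1W (hw : 0 < w) (i : Fin 4) : accW hw i ≠ anc1W w :=
  fun h => by have := cw_val_lt i ⟨0, hw⟩; have := congrArg Fin.val h; simp [accW] at *; omega
/-- An acceptance wire is not the second ancilla. [folklore] -/
theorem accW_ne_anc2W (hw : 0 < w) (i : Fin 4) : accW hw i ≠ anc2W w :=
  fun h => by have := cw_val_lt i ⟨0, hw⟩; have := congrArg Fin.val h; simp [accW] at *; omega
/-- An acceptance wire is not the flag. [folklore] -/
theorem accW_ne_flagW (hw : 0 < w) (i : Fin 4) : accW hw i ≠ flagW w :=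
  fun h => by have := cw_val_lt i ⟨0, hw⟩; have := congrArg Fin.val h; simp [accW] at *; omega
/-- The ancillas differ. [folklore] -/
theorem anc1W_ne_anc2W : anc1W w ≠ anc2W w := fun h => by have := congrArg Fin.val h; simp at this
/-- The first ancilla is not the flag. [folklore] -/
theorem anc1W_ne_flagW : anc1W w ≠ flagW w := fun h => by have := congrArg Fin.val h; simp at this
/-- The second ancilla is not the flag. [folklore] -/
theorem anc2W_ne_flagW : anc2W w ≠ flagW w := fun h => by have := congrArg Fin.val h; simp at this

/-- **The OR program**: negate the four acceptance wires, `anc1 := a₀' ∧ a₁'`, `anc2 := anc1 ∧ a₂'`,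
`flag := anc2 ∧ a₃'`, negate the flag: on clean ancillas `flag = a₀ ∨ a₁ ∨ a₂ ∨ a₃` (De Morgan); empty
for the empty register. [cite: NielsenChuang2010, §3.2.5] -/
def orOps (w : ℕ) : List (RevOp (Kw w)) :=
  if hw : 0 < w then
    [RevOp.not (accW hw 0), RevOp.not (accW hw 1), RevOp.not (accW hw 2), RevOp.not (accW hw 3),
     RevOp.toffoli (accW hw 0) (accW hw 1) (anc1W w)
       (fun h => by have := congrArg Fin.val h; simp [accW] at this; omega) (accW_ne_anc1W hw 0) (accW_ne_anc1W hw 1),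
     RevOp.toffoli (anc1W w) (accW hw 2) (anc2W w) (accW_ne_anc1W hw 2).symm anc1W_ne_anc2W (accW_ne_anc2W hw 2),
     RevOp.toffoli (anc2W w) (accW hw 3) (flagW w) (accW_ne_anc2W hw 3).symm anc2W_ne_flagW (accW_ne_flagW hw 3),
     RevOp.not (flagW w)]
  else []

/-- **The OR program on clean ancillas**: the flag becomes `a₀ ∨ a₁ ∨ a₂ ∨ a₃`.
[cite: NielsenChuang2010, §3.2.5] -/
theorem revEval_orOps_flagW (hw : 0 < w) (z : QReg (Kw w)) (h1 : z (anc1W w) = false) (h2 : z (anc2W w) = false)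
    (hf : z (flagW w) = false) :
    revEval (orOps w) z (flagW w) = (z (accW hw 0) || z (accW hw 1) || z (accW hw 2) || z (accW hw 3)) := by
  rw [orOps, dif_pos hw]
  -- distinctness
  have n01 : accW hw 0 ≠ accW hw 1 := fun h => by have := congrArg Fin.val h; simp [accW] at this; omega
  have n02 : accW hw 0 ≠ accW hw 2 := fun h => by have := congrArg Fin.val h; simp [accW] at this; omega
  have n03 : accW hw 0 ≠ accW hw 3 := fun h => by have := congrArg Fin.val h; simp [accW] at this; omega
  have n12 : accW hw 1 ≠ accW hw 2 := fun h => by have := congrArg Fin.val h; simp [accW] at this; omega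
  have n13 : accW hw 1 ≠ accW hw 3 := fun h => by have := congrArg Fin.val h; simp [accW] at this; omega
  have n23 : accW hw 2 ≠ accW hw 3 := fun h => by have := congrArg Fin.val h; simp [accW] at this; omega
  have a1 := accW_ne_anc1W hw; have a2 := accW_ne_anc2W hw; have af := accW_ne_flagW hw
  -- after the four negations
  have hnots : ∀ v : QReg (Kw w), revEval [RevOp.not (accW hw 0), RevOp.not (accW hw 1), RevOp.not (accW hw 2),
      RevOp.not (accW hw 3)] v = fun q => if q ∈ [accW hw 0, accW hw 1, accW hw 2, accW hw 3] then !v q else v q := by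
    intro v
    exact revEval_map_not [accW hw 0, accW hw 1, accW hw 2, accW hw 3] (by simp [n01, n02, n03, n12, n13, n23]) v
  change revEval [RevOp.toffoli (accW hw 0) (accW hw 1) (anc1W w) _ (a1 0) (a1 1),
      RevOp.toffoli (anc1W w) (accW hw 2) (anc2W w) (a1 2).symm anc1W_ne_anc2W (a2 2),
      RevOp.toffoli (anc2W w) (accW hw 3) (flagW w) (a2 3).symm anc2W_ne_flagW (af 3), RevOp.not (flagW w)]
    (revEval [RevOp.not (accW hw 0), RevOp.not (accW hw 1), RevOp.not (accW hw 2), RevOp.not (accW hw 3)] z) (flagW w) = _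
  rw [hnots]
  set s := (fun q => if q ∈ [accW hw 0, accW hw 1, accW hw 2, accW hw 3] then !z q else z q : QReg (Kw w)) with hs
  have s_acc : ∀ i : Fin 4, s (accW hw i) = !z (accW hw i) := by
    intro i; fin_cases i <;> simp [hs]
  have s_anc1 : s (anc1W w) = false := by simp [hs, (a1 _).symm, h1]
  have s_anc2 : s (anc2W w) = false := by simp [hs, (a2 _).symm, h2]
  have s_flag : s (flagW w) = false := by simp [hs, (af _).symm, hf]
  -- the three Toffoli gates and the final negation, evaluated at the wires that matter
  simp only [revEval, RevOp.eval]
  simp only [Function.update_self, Function.update_of_ne anc1W_ne_anc2W.symm, Function.update_of_ne (a1 2),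
    Function.update_of_ne (a1 3), Function.update_of_ne anc2W_ne_flagW.symm, Function.update_of_ne (a2 3),
    Function.update_of_ne anc1W_ne_flagW.symm, s_flag, s_anc1, s_anc2, s_acc]
  cases z (accW hw 0) <;> cases z (accW hw 1) <;> cases z (accW hw 2) <;> cases z (accW hw 3) <;> decide

/-- The OR program does not mention the fresh wire. [folklore] -/
theorem freshW_not_mem_wireSet_orOps : ∀ op ∈ orOps w, freshW w ∉ op.wireSet := by
  intro op hop
  unfold orOps at hop
  split_ifs at hop with hw
  · have hacc : ∀ i, accW hw i ≠ freshW w := fun i h => by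
      have := cw_val_lt i ⟨0, hw⟩; have := congrArg Fin.val h; simp [accW] at *; omega
    have h1 : anc1W w ≠ freshW w := fun h => by have := congrArg Fin.val h; simp at this
    have h2 : anc2W w ≠ freshW w := fun h => by have := congrArg Fin.val h; simp at this
    have h3 : flagW w ≠ freshW w := fun h => by have := congrArg Fin.val h; simp at this
    simp only [List.mem_cons, List.mem_nil_iff, or_false] at hop
    rcases hop with rfl | rfl | rfl | rfl | rfl | rfl | rfl | rfl <;>
      simp [RevOp.wireSet, (hacc _).symm, h1.symm, h2.symm, h3.symm]
  · simp at hop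

/-- The preparation program does not mention the fresh wire. [folklore] -/
theorem freshW_not_mem_wireSet_prepOps (x : QReg n) : ∀ op ∈ prepOps (m := m) x, freshW (n + m) ∉ op.wireSet := by
  intro op hop
  simp only [prepOps, List.mem_map] at hop
  obtain ⟨q, hq, rfl⟩ := hop
  simp only [RevOp.wireSet, Finset.mem_singleton]
  obtain ⟨i, l, -, rfl⟩ := (mem_prepWires_iff x q).1 hq
  intro h
  have := cw_val_lt i (Fin.castAdd m l); have := congrArg Fin.val h; simp at *; omega

/-! ### The working circuit -/

/-- The four copies of `C`, one per block. [cite: NielsenChuang2010, §2.1.7] -/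
def copiesGates (C : QCircuit cliffordT w) : List (QGate cliffordT (Kw w)) :=
  (List.finRange 4).flatMap fun i => (mapWires (copyEmb i) C).gates

/-- **The working circuit of a block**: prepare `x` on every copy, run the copies, OR the acceptance
wires into the flag. [cite: AaronsonAmbainis2018, §6 Lemma 24 (p. 26)] -/
def mainGates (C : QCircuit cliffordT (n + m)) (x : QReg n) : List (QGate cliffordT (Kw (n + m))) :=
  revCompile (prepOps (m := m) x) ++ (copiesGates C ++ revCompile (orOps (n + m)))

/-- The working circuit is oracle-free when `C` is. [folklore] -/
theorem mainGates_isOracleFree {C : QCircuit cliffordT (n + m)} (hC : C.IsOracleFree) (x : QReg n) :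
    ∀ g ∈ mainGates C x, g.IsOracleFree := by
  intro g hg
  simp only [mainGates, List.mem_append] at hg
  rcases hg with hg | hg | hg
  · exact revCompile_isOracleFree _ g hg
  · simp only [copiesGates, List.mem_flatMap, List.mem_finRange, true_and] at hg
    obtain ⟨i, hg⟩ := hg
    exact isOracleFree_mapWires (copyEmb i) hC g hg
  · exact revCompile_isOracleFree _ g hg

/-- **The fresh wire is untouched by the working circuit.** [folklore] -/
theorem freshW_not_mem_wires_mainGates (C : QCircuit cliffordT (n + m)) (x : QReg n) :
    ∀ g ∈ mainGates C x, freshW (n + m) ∉ g.wires := by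
  intro g hg hmem
  simp only [mainGates, List.mem_append] at hg
  rcases hg with hg | hg | hg
  · obtain ⟨op, hop, hsub⟩ := exists_wireSet_of_mem_revCompile hg
    exact freshW_not_mem_wireSet_prepOps x op hop (hsub hmem)
  · simp only [copiesGates, List.mem_flatMap, List.mem_finRange, true_and, gates_mapWires, List.mem_map] at hg
    obtain ⟨i, g', -, rfl⟩ := hg
    obtain ⟨j, hj⟩ := wires_mapWiresGate_subset (copyEmb i) g' _ hmem
    have := cw_val_lt i j
    have hv := congrArg Fin.val hj
    simp at hv this
    omega
  · obtain ⟨op, hop, hsub⟩ := exists_wireSet_of_mem_revCompile hg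
    exact freshW_not_mem_wireSet_orOps op hop (hsub hmem)

/-- Size of the working circuit: `4 |C| + 24 (4n + 8)` gates at most. [folklore] -/
theorem length_mainGates_le (C : QCircuit cliffordT (n + m)) (x : QReg n) :
    (mainGates C x).length ≤ 4 * C.size + 96 * n + 192 := by
  have hprep : (prepOps (m := m) x).length ≤ 4 * n := by
    rw [prepOps, List.length_map, prepWires, List.length_flatMap]
    have : ∀ i ∈ List.finRange 4, ((List.finRange n).filterMap fun l =>
        if x l = true then some (cw i (Fin.castAdd m l)) else none).length ≤ n := fun i _ =>
      (List.length_filterMap_le _ _).trans (by simp)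
    calc ((List.finRange 4).map fun i => ((List.finRange n).filterMap fun l =>
            if x l = true then some (cw i (Fin.castAdd m l)) else none).length).sum
        ≤ ((List.finRange 4).map fun _ => n).sum := List.sum_le_sum (fun i hi => this i hi)
      _ = 4 * n := by simp; ring
  have hor : (orOps (n + m)).length ≤ 8 := by
    unfold orOps; split_ifs <;> simp
  have hcop : (copiesGates C).length = 4 * C.size := by
    simp [copiesGates, List.length_flatMap, QCircuit.size]
    ring
  simp only [mainGates, List.length_append, hcop]
  have h1 := length_revCompile_le (prepOps (m := m) x)
  have h2 := length_revCompile_le (orOps (n + m))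
  omega

/-! ### The state of the working circuit and the weight of the flag -/

/-- **The state of the working circuit** started on `|0…0⟩`. [cite: AaronsonAmbainis2018, §6 Lemma 24 (p. 26)] -/
def mainState (C : QCircuit cliffordT (n + m)) (x : QReg n) : QReg (Kw (n + m)) → ℂ :=
  (⟨mainGates C x⟩ : QCircuit cliffordT (Kw (n + m))).toMatrix 0 *ᵥ basisState (fun _ => false)

/-- The state after preparation and the copies: the product of four copies of `C |x 0^m⟩` with the
prepared classical content. [cite: NielsenChuang2010, §2.1.7 eq. (2.45)] -/
theorem copies_prep_state (C : QCircuit cliffordT (n + m)) (x : QReg n) :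
    (⟨copiesGates C⟩ : QCircuit cliffordT (Kw (n + m))).toMatrix 0 *ᵥ
        ((⟨revCompile (prepOps (m := m) x)⟩ : QCircuit cliffordT (Kw (n + m))).toMatrix 0 *ᵥ basisState (fun _ => false)) =
      prodState copyEmb (fun _ => C.toMatrix 0 *ᵥ basisState (padInput x m)) (prepLabel (m := m) x) := by
  rw [revCompile_mulVec_basisState, revEval_prepOps_zero, basisState_eq_prodState copyEmb (prepLabel (m := m) x)]
  simp only [prepLabel_comp_copyEmb]
  exact toMatrix_flatMap_mapWires_mulVec_prodState 0 copyEmb_blockDisjoint (fun _ => C) _ _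

/-- **The weight of the flag in the working state** is the OR-amplified acceptance probability
`1 − (1 − p)^4`. [cite: AaronsonAmbainis2018, §6 Lemma 24 (p. 26)] [cite: NielsenChuang2010, Box 3.4] -/
theorem flagWeight_mainState (C : QCircuit cliffordT (n + m)) (x : QReg n) :
    (∑ u : QReg (Kw (n + m)), if u (flagW (n + m)) = true then ‖mainState C x u‖ ^ 2 else 0) =
      1 - (1 - C.acceptProb 0 x) ^ 4 := by
  have hsplit : (⟨mainGates C x⟩ : QCircuit cliffordT (Kw (n + m))) =
      (⟨revCompile (prepOps (m := m) x)⟩ : QCircuit cliffordT (Kw (n + m))).append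
        ((⟨copiesGates C⟩ : QCircuit cliffordT (Kw (n + m))).append ⟨revCompile (orOps (n + m))⟩) := rfl
  rw [mainState, hsplit, QCircuit.toMatrix_append, QCircuit.toMatrix_append, ← Matrix.mulVec_mulVec, ← Matrix.mulVec_mulVec,
    copies_prep_state, sum_ite_normSq_mulVec_of_perm (revPerm (orOps (n + m))) (revCompile_mulVec_basisState 0 _)]
  -- unit block state
  set φ : QReg (n + m) → ℂ := C.toMatrix 0 *ᵥ basisState (padInput x m) with hφ
  have hunit : normSq φ = 1 := by
    rw [hφ, normSq_mulVec_of_mem_unitaryGroup (QCircuit.toMatrix_mem_unitaryGroup_holds cliffordT_isUnitary_holds 0 C),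
      normSq_basisState]
  rw [← acceptWeight_eq_acceptProb 0 C x, ← sum_ite_exists_normSq_prodState_const copyEmb_blockDisjoint hunit (prepLabel (m := m) x)]
  refine Finset.sum_congr rfl fun z _ => ?_
  -- where the product state is nonzero the ancillas are clean and the flag reads the OR
  by_cases hz : ∀ q, OffBlocks (copyEmb (w := n + m)) q → z q = prepLabel (m := m) x q
  · have hval : ∀ q : Fin (Kw (n + m)), 4 * (n + m) ≤ (q : ℕ) → z q = false := fun q hq => by
      rw [hz q (offBlocks_of_le hq), prepLabel_of_le x hq]
    have h1 : z (anc1W (n + m)) = false := hval _ (by simp)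
    have h2 : z (anc2W (n + m)) = false := hval _ (by simp)
    have hf : z (flagW (n + m)) = false := hval _ (by simp)
    have hev : (revPerm (orOps (n + m)) z (flagW (n + m)) = true) ↔
        ∃ i, ∃ h : 0 < n + m, z (copyEmb i ⟨0, h⟩) = true := by
      change (revEval (orOps (n + m)) z (flagW (n + m)) = true) ↔ _
      by_cases hw : 0 < n + m
      · rw [revEval_orOps_flagW hw z h1 h2 hf]
        have key : ∀ a b c d : Bool, ((a || b || c || d) = true) ↔ (a = true ∨ b = true ∨ c = true ∨ d = true) := by
          decide
        rw [key]
        constructor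
        · rintro (h | h | h | h)
          · exact ⟨0, hw, h⟩
          · exact ⟨1, hw, h⟩
          · exact ⟨2, hw, h⟩
          · exact ⟨3, hw, h⟩
        · rintro ⟨i, hw', h⟩
          revert h
          fin_cases i <;> intro h
          · exact Or.inl h
          · exact Or.inr (Or.inl h)
          · exact Or.inr (Or.inr (Or.inl h))
          · exact Or.inr (Or.inr (Or.inr h))
      · rw [orOps, dif_neg hw]
        simp only [revEval, hf]
        constructor
        · intro h; exact absurd h (by simp)
        · rintro ⟨_, h, _⟩; exact absurd h hw
    by_cases hcase : revPerm (orOps (n + m)) z (flagW (n + m)) = true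
    · rw [if_pos hcase, if_pos (hev.1 hcase)]
    · rw [if_neg hcase, if_neg (fun h => hcase (hev.2 h))]
  · have hzero : prodState copyEmb (fun _ => φ) (prepLabel (m := m) x) z = 0 := by
      rw [prodState_apply, if_neg hz, zero_mul]
    simp [hzero]

/-- The working state is a unit vector. [cite: NielsenChuang2010, §2.1.6] -/
theorem normSq_mainState {C : QCircuit cliffordT (n + m)} (x : QReg n) : normSq (mainState C x) = 1 := by
  rw [mainState, normSq_mulVec_of_mem_unitaryGroup (QCircuit.toMatrix_mem_unitaryGroup_holds cliffordT_isUnitary_holds 0 _),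
    normSq_basisState]

end Lemma24

end Literature.Computability.QuantumComplexity

end
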